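import Summits.NavierStokesRegularity.FluidComputer.PalasekTowerStrainDoorAtH2
import Summits.NavierStokesRegularity.NavierStokesRegularity.Theorems.EpisodeBaseT.Negative.CertificateSharpAtTunedPrice

/-!
# THE `H²` STRAIN CERTIFICATE (route (B), `StrainDoor.CertificateDataH2`, p536855): THE TOLERANCE DOMINATES THE SUP DATUM
# DEFECT — `‖w 0 y − U y‖ ≤ δ` BY AGMON WITH THE SAME ABSTRACT CONSTANT — so the junk exclusions of the `L²` letters
# persist without any numeral: `‖w 0‖ < Y₀ + δ`, no steady reference, sup-speed GAIN `> Y₁ − Y₀ + η` inside the window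

Cell `ns-blowup`, seat `ns-blowup-refuter4` (g10, K215; ledger refuter of record for route `PalasekTowerBreakdown` rev 19, crux
stmt-NavierStokesRegularity-20303 `EpisodeBaseT := EpisodeBaseGAt TowerRates.tuned`; LEAD line `straindoor`, road (B) = the
`H²`-currency letter `StrainDoor.CertificateDataH2 R U ρ w r ϖ G σ₂ σ₃ Rr L H₁ ψ₁ ψ₂ X₁ Bw E₀ κ μ D₁ Ψ₁ D₂ Ψ₂ δ η` of
`PalasekTowerStrainDoorAtH2.lean`). Negative-lane SUPPORT (`--supports 20303`), no Theses import; theorems only.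

Unlike the `L²` letters (`CertificateDataSharp`, `RawCertificateData`: field `datum_sup`, `D ≤ 1/4` — K208/K212), the `H²` letter has NO
sup-norm datum field: the reference's initial slice `w 0` is tied to the sub-`Y₀` datum `U` only through `E₀, D₁, D₂` (`L²`, `H¹`, `H²`
defects), and its tolerance `δ` is not `≤ 1/2` but only bounded by the readout margins (`η + δ ≤ Y₁/3`). Is a STEADY strong reference
(or a late bump) then a certificate? NO — and no number is needed: the readout domination `readout_le` at `t = 0` gives
`δ ≥ A·(3·X₁(0)·2(D₂+Ψ₂))^{1/4} ≥ A·(3 D₁ D₂)^{1/4}` (`X₁(0) ≥ √2(D₁+Ψ₁) ≥ D₁`, `Ψ₁, Ψ₂ ≥ 0` from the source fields), while Agmon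
with THE SAME tree constant `A = agmonConst` (`norm_le_agmonConst_mul_rpow_of_le`, lit g17) gives `‖U y − w 0 y‖ ≤ A·(3 D₁ D₂)^{1/4}`.
Hence (`R`-generic):

* `Ψ₁_nonneg`, `Ψ₂_nonneg`, `D₁_nonneg`, `D₂_nonneg`, `delta_ge_agmon : agmonConst * (3 * D₁ * D₂) ^ (1/4) ≤ δ`, `delta_nonneg`;
* `datum_sub_sobolev` (the datum defect `U − w 0` is `H^∞`), `norm_datum_sub_le_delta : ‖w 0 y − U y‖ ≤ δ`;
* `reference_initial_speed_lt : ‖w 0 y‖ < Y₀(R) + δ`; `false_of_steady (w w₀ = w 0) (Y₀ ≤ Y₁) : False`;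
* `speed_gain : ∃ ‖x‖ ≤ ρ, ∀ y, ‖w 0 y‖ + (Y₁ − Y₀) + η < ‖w(w₀) x‖`;
* at `tuned` (`2Y₀ ≤ Y₁`): `tuned_not_steady`, `tuned_speed_gain : ∃ ‖x‖ ≤ ρ, ∀ y, ‖w 0 y‖ + Y₀ + η < ‖w(w₀) x‖`, with
  `w₀·A₀ ≤ 170`, `Y₀·w₀ ≤ 1/4` — the reference GAINS more than one datum-scale `Y₀` of sup speed inside `170` strain times.

So the `H²` letter, too, is inhabited only by a genuine amplifying near-exact Navier–Stokes run; the design tests of the LEAD's memo §7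
apply verbatim to road (B).

WHAT THIS IS NOT: not NS — inequalities between the fields of a posited certificate (Agmon + bookkeeping); no design, run,
certificate or flow is exhibited or excluded beyond the junk classes named; `CertificateDataH2`/20303 stay OPEN.
-/

noncomputable section

namespace Summit.NavierStokesRegularity.EpisodeBaseTCertificateH2DatumSup

open Set MeasureTheory Metric Function Real
open scoped ENNReal NNReal ContDiff
open Literature.Analysis Literature.Analysis.FluidPDE
open Summit.NavierStokesRegularity.FluidComputer
open Summit.NavierStokesRegularity.FluidComputer.PalasekTowerClayBridge
open Summit.NavierStokesRegularity.FluidComputer.PalasekTowerClayBridge.StrainDoor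

/-- A smooth compactly supported field on `ℝ³` is rapidly decaying (Fefferman's (4)). [cite: FeffermanClay2006, (4)] -/
private theorem hasRapidSpatialDecay_of_hasCompactSupport
    {φ : EuclideanSpace ℝ (Fin 3) → EuclideanSpace ℝ (Fin 3)} (hsm : ContDiff ℝ ∞ φ)
    (hc : HasCompactSupport φ) : HasRapidSpatialDecay φ := by
  intro n K
  have hcont : Continuous fun x => (1 + ‖x‖) ^ K * ‖iteratedFDeriv ℝ n φ x‖ :=
    ((continuous_const.add continuous_norm).pow K).mul
      (hsm.continuous_iteratedFDeriv (m := n) (mod_cast le_top)).norm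
  have hsupp : HasCompactSupport fun x => (1 + ‖x‖) ^ K * ‖iteratedFDeriv ℝ n φ x‖ :=
    ((hc.iteratedFDeriv n).norm).mul_left
  obtain ⟨C, hC⟩ := hcont.bounded_above_of_compact_support hsupp
  exact ⟨C, fun x => by have h := hC x; rwa [Real.norm_eq_abs, abs_of_nonneg (by positivity)] at h⟩

section Generic

variable {R : TowerRates} {U : EuclideanSpace ℝ (Fin 3) → EuclideanSpace ℝ (Fin 3)} {ρ : ℝ}
  {w r : ℝ → EuclideanSpace ℝ (Fin 3) → EuclideanSpace ℝ (Fin 3)} {ϖ : ℝ → EuclideanSpace ℝ (Fin 3) → ℝ}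
  {G σ₂ σ₃ Rr L H₁ ψ₁ ψ₂ X₁ : ℝ → ℝ} {Bw E₀ κ μ D₁ Ψ₁ D₂ Ψ₂ δ η : ℝ}

/-- `0` lies in the window `[0, w₀(R)]`. [folklore] -/
private theorem zero_mem (R : TowerRates) : (0 : ℝ) ∈ Icc 0 (Host.wfirstAt R) :=
  ⟨le_rfl, (Host.wfirstAt_pos R).le⟩

/-- `0 ≤ D₁` (it dominates an integral of squares). [folklore] -/
theorem D₁_nonneg (c : CertificateDataH2 R U ρ w r ϖ G σ₂ σ₃ Rr L H₁ ψ₁ ψ₂ X₁ Bw E₀ κ μ D₁ Ψ₁ D₂ Ψ₂ δ η) : 0 ≤ D₁ :=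
  (integral_nonneg fun _ => frobeniusNormSq_nonneg _).trans c.datum_H1

/-- `0 ≤ D₂`. [folklore] -/
theorem D₂_nonneg (c : CertificateDataH2 R U ρ w r ϖ G σ₂ σ₃ Rr L H₁ ψ₁ ψ₂ X₁ Bw E₀ κ μ D₁ Ψ₁ D₂ Ψ₂ δ η) : 0 ≤ D₂ :=
  (Finset.sum_nonneg fun _ _ => integral_nonneg fun _ => frobeniusNormSq_nonneg _).trans c.datum_H2

/-- `0 ≤ Ψ₁` (the first source term is pointwise nonnegative on the window). [folklore] -/
theorem Ψ₁_nonneg (c : CertificateDataH2 R U ρ w r ϖ G σ₂ σ₃ Rr L H₁ ψ₁ ψ₂ X₁ Bw E₀ κ μ D₁ Ψ₁ D₂ Ψ₂ δ η) : 0 ≤ Ψ₁ := by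
  have hψ : ∀ s ∈ Icc (0 : ℝ) (Host.wfirstAt R), 0 ≤ ψ₁ s := fun s hs => by
    have h1 := c.ψ₁_def s hs
    have hσ : 0 ≤ σ₂ s := (norm_nonneg _).trans (c.hess s hs 0)
    have hκ := c.κ_pos
    have hi : 0 ≤ ∫ x, ‖r s x - (0 : EuclideanSpace ℝ (Fin 3))‖ ^ 2 := integral_nonneg fun _ => sq_nonneg _
    have h3 : 0 ≤ 3 * σ₂ s / κ * L s ^ 2 := by positivity
    linarith
  exact (intervalIntegral.integral_nonneg (Host.wfirstAt_pos R).le hψ).trans c.Ψ₁_def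

/-- `√2 (D₁ + Ψ₁) ≤ X₁(0)` and hence `D₁ ≤ X₁(0)`. [folklore] -/
theorem D₁_le_X₁_zero (c : CertificateDataH2 R U ρ w r ϖ G σ₂ σ₃ Rr L H₁ ψ₁ ψ₂ X₁ Bw E₀ κ μ D₁ Ψ₁ D₂ Ψ₂ δ η) :
    D₁ ≤ X₁ 0 := by
  have h := c.X₁_dom 0 (zero_mem R)
  rw [intervalIntegral.integral_same, Real.exp_zero, one_mul] at h
  have h2 : (1 : ℝ) ≤ Real.sqrt 2 := by
    have := Real.sqrt_le_sqrt (show (1 : ℝ) ≤ 2 by norm_num); rwa [Real.sqrt_one] at this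
  have hD := D₁_nonneg c
  have hΨ := Ψ₁_nonneg c
  nlinarith

/-- `0 ≤ X₁ s` on the window. [folklore] -/
theorem X₁_nonneg (c : CertificateDataH2 R U ρ w r ϖ G σ₂ σ₃ Rr L H₁ ψ₁ ψ₂ X₁ Bw E₀ κ μ D₁ Ψ₁ D₂ Ψ₂ δ η)
    {s : ℝ} (hs : s ∈ Icc (0 : ℝ) (Host.wfirstAt R)) : 0 ≤ X₁ s := by
  have h := c.X₁_dom s hs
  have hD := D₁_nonneg c
  have hΨ := Ψ₁_nonneg c
  have : 0 ≤ Real.sqrt 2 * (Real.exp (∫ τ in (0 : ℝ)..s, (4 * G τ + 3 * κ * σ₂ τ)) * (D₁ + Ψ₁)) := by positivity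
  linarith

/-- `0 ≤ Ψ₂` (the second source term is pointwise nonnegative on the window). [folklore] -/
theorem Ψ₂_nonneg (c : CertificateDataH2 R U ρ w r ϖ G σ₂ σ₃ Rr L H₁ ψ₁ ψ₂ X₁ Bw E₀ κ μ D₁ Ψ₁ D₂ Ψ₂ δ η) : 0 ≤ Ψ₂ := by
  have hψ : ∀ s ∈ Icc (0 : ℝ) (Host.wfirstAt R), 0 ≤ ψ₂ s := fun s hs => by
    have h1 := c.ψ₂_def s hs
    have hσ₂ : 0 ≤ σ₂ s := (norm_nonneg _).trans (c.hess s hs 0)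
    have hσ₃ : 0 ≤ σ₃ s := (norm_nonneg _).trans (c.third s hs 0)
    have hκ := c.κ_pos
    have hX := X₁_nonneg c hs
    have hH : 0 ≤ H₁ s := (integral_nonneg fun _ => sq_nonneg _).trans (c.H₁_def s hs)
    have h3 : 0 ≤ 27 * σ₂ s / κ * X₁ s + 9 * σ₃ s / κ ^ 2 * L s ^ 2 + 6 / 1 * H₁ s := by positivity
    linarith
  exact (intervalIntegral.integral_nonneg (Host.wfirstAt_pos R).le hψ).trans c.Ψ₂_def

/-- **The tolerance dominates the Agmon bound of the datum defect**: `A·(3 D₁ D₂)^{1/4} ≤ δ` (the readout domination at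
`t = 0`, `X₁(0) ≥ D₁`, `2(D₂ + Ψ₂) ≥ D₂`). [cite: RobinsonRodrigoSadowskiCUP2016, Thm 1.20] -/
theorem delta_ge_agmon (c : CertificateDataH2 R U ρ w r ϖ G σ₂ σ₃ Rr L H₁ ψ₁ ψ₂ X₁ Bw E₀ κ μ D₁ Ψ₁ D₂ Ψ₂ δ η) :
    agmonConst * (3 * D₁ * D₂) ^ (1 / 4 : ℝ) ≤ δ := by
  have hr := c.readout_le 0 (zero_mem R)
  rw [intervalIntegral.integral_same, Real.exp_zero, one_mul] at hr
  have hD₁ := D₁_nonneg c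
  have hD₂ := D₂_nonneg c
  have hΨ₂ := Ψ₂_nonneg c
  have hX := D₁_le_X₁_zero c
  have hmono : 3 * D₁ * D₂ ≤ 3 * X₁ 0 * (2 * (D₂ + Ψ₂)) :=
    mul_le_mul (by linarith) (by linarith) hD₂ (by linarith)
  have hrp : (3 * D₁ * D₂) ^ (1 / 4 : ℝ) ≤ (3 * X₁ 0 * (2 * (D₂ + Ψ₂))) ^ (1 / 4 : ℝ) :=
    Real.rpow_le_rpow (by positivity) hmono (by norm_num)
  exact (mul_le_mul_of_nonneg_left hrp agmonConst_nonneg).trans hr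

/-- The tolerance of an `H²` certificate is nonnegative. [folklore] -/
theorem delta_nonneg (c : CertificateDataH2 R U ρ w r ϖ G σ₂ σ₃ Rr L H₁ ψ₁ ψ₂ X₁ Bw E₀ κ μ D₁ Ψ₁ D₂ Ψ₂ δ η) : 0 ≤ δ := by
  have h := delta_ge_agmon c
  have hD₁ := D₁_nonneg c
  have hD₂ := D₂_nonneg c
  have : 0 ≤ agmonConst * (3 * D₁ * D₂) ^ (1 / 4 : ℝ) := mul_nonneg agmonConst_nonneg (by positivity)
  linarith

/-- The datum defect `U − w 0` is `H^∞` (`U` is smooth with compact support, `w 0` is a Tao-class slice). [folklore] -/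
theorem datum_sub_sobolev (c : CertificateDataH2 R U ρ w r ϖ G σ₂ σ₃ Rr L H₁ ψ₁ ψ₂ X₁ Bw E₀ κ μ D₁ Ψ₁ D₂ Ψ₂ δ η) (n : ℕ) :
    ∫⁻ x, ‖iteratedFDeriv ℝ n (fun y => U y - w 0 y) x‖ₑ ^ 2 < ⊤ := by
  have hU : ContDiff ℝ ∞ U := c.datum_smooth
  have hUc : HasCompactSupport U :=
    (isCompact_closedBall (0 : EuclideanSpace ℝ (Fin 3)) ρ).of_isClosed_subset (isClosed_tsupport U) c.datum_support
  have hw0 : ContDiff ℝ ∞ (w 0) := c.run.contDiff_velocity (zero_mem R)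
  have hUn : ∫⁻ x, ‖iteratedFDeriv ℝ n U x‖ₑ ^ 2 < ⊤ :=
    (hasRapidSpatialDecay_of_hasCompactSupport hU hUc).lintegral_enorm_iteratedFDeriv_sq_lt_top n
  obtain ⟨C, hC⟩ := c.sobolev n
  have hwn : ∫⁻ x, ‖iteratedFDeriv ℝ n (w 0) x‖ₑ ^ 2 < ⊤ := (hC 0 (zero_mem R)).trans_lt ENNReal.coe_lt_top
  have heq : ∀ x, iteratedFDeriv ℝ n (fun y => U y - w 0 y) x = iteratedFDeriv ℝ n U x - iteratedFDeriv ℝ n (w 0) x :=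
    fun x => fun_iteratedFDeriv_sub_apply (hU.of_le (mod_cast le_top)).contDiffAt (hw0.of_le (mod_cast le_top)).contDiffAt
  calc ∫⁻ x, ‖iteratedFDeriv ℝ n (fun y => U y - w 0 y) x‖ₑ ^ 2
      = ∫⁻ x, ‖iteratedFDeriv ℝ n U x - iteratedFDeriv ℝ n (w 0) x‖ₑ ^ 2 := lintegral_congr fun x => by rw [heq]
    _ ≤ 2 * (∫⁻ x, ‖iteratedFDeriv ℝ n U x‖ₑ ^ 2) + 2 * ∫⁻ x, ‖iteratedFDeriv ℝ n (w 0) x‖ₑ ^ 2 :=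
        lintegral_enorm_sq_sub_le ((hU.continuous_iteratedFDeriv (m := n) (mod_cast le_top)).aestronglyMeasurable)
    _ < ⊤ := by
        have h1 : 2 * (∫⁻ x, ‖iteratedFDeriv ℝ n U x‖ₑ ^ 2) < ⊤ := ENNReal.mul_lt_top (by simp) hUn
        have h2 : 2 * (∫⁻ x, ‖iteratedFDeriv ℝ n (w 0) x‖ₑ ^ 2) < ⊤ := ENNReal.mul_lt_top (by simp) hwn
        exact ENNReal.add_lt_top.2 ⟨h1, h2⟩

/-- **THE TOLERANCE DOMINATES THE SUP DATUM DEFECT**: `‖w 0 y − U y‖ ≤ δ` for every `y` (Agmon on `U − w 0` with the tree's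
constant `A = agmonConst`, then `delta_ge_agmon`). [cite: RobinsonRodrigoSadowskiCUP2016, Thm 1.20] -/
theorem norm_datum_sub_le_delta (c : CertificateDataH2 R U ρ w r ϖ G σ₂ σ₃ Rr L H₁ ψ₁ ψ₂ X₁ Bw E₀ κ μ D₁ Ψ₁ D₂ Ψ₂ δ η)
    (y : EuclideanSpace ℝ (Fin 3)) : ‖w 0 y - U y‖ ≤ δ := by
  have hφ : ContDiff ℝ ∞ (fun y => U y - w 0 y) := c.datum_smooth.sub (c.run.contDiff_velocity (zero_mem R))
  have hA := norm_le_agmonConst_mul_rpow_of_le hφ (datum_sub_sobolev c 0) (datum_sub_sobolev c 1)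
    (datum_sub_sobolev c 2) (datum_sub_sobolev c 3) c.datum_H1 c.datum_H2 y
  rw [← norm_neg, neg_sub]
  exact hA.trans (delta_ge_agmon c)

/-- **The reference of an `H²` certificate starts sup-close to a sub-`Y₀` datum**: `‖w 0 y‖ < Y₀(R) + δ` everywhere. [folklore] -/
theorem reference_initial_speed_lt (c : CertificateDataH2 R U ρ w r ϖ G σ₂ σ₃ Rr L H₁ ψ₁ ψ₂ X₁ Bw E₀ κ μ D₁ Ψ₁ D₂ Ψ₂ δ η)
    (y : EuclideanSpace ℝ (Fin 3)) : ‖w 0 y‖ < R.Y 0 + δ := by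
  have h1 := norm_datum_sub_le_delta c y
  have h2 := c.datum_lt y
  calc ‖w 0 y‖ = ‖U y + (w 0 y - U y)‖ := by congr 1; abel
    _ ≤ ‖U y‖ + ‖w 0 y - U y‖ := norm_add_le _ _
    _ < R.Y 0 + δ := by linarith

/-- **No time-independent reference** in the `H²` letter either, as soon as `Y₀(R) ≤ Y₁(R)`: the speed readout asks
`‖w(w₀) x‖ ≥ Y₁ + η + δ` somewhere while `‖w 0‖ < Y₀ + δ` everywhere. [folklore] -/
theorem false_of_steady (c : CertificateDataH2 R U ρ w r ϖ G σ₂ σ₃ Rr L H₁ ψ₁ ψ₂ X₁ Bw E₀ κ μ D₁ Ψ₁ D₂ Ψ₂ δ η)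
    (hsteady : w (Host.wfirstAt R) = w 0) (hY : R.Y 0 ≤ R.Y 1) : False := by
  obtain ⟨x, -, hx⟩ := c.speed
  have h0 := reference_initial_speed_lt c x
  have hη := c.η_pos
  rw [hsteady] at hx
  linarith

/-- **SUP-SPEED GAIN**: at the speed readout point, `‖w(w₀) x‖` exceeds EVERY initial speed `‖w 0 y‖` by more than
`Y₁(R) − Y₀(R) + η`. [folklore] -/
theorem speed_gain (c : CertificateDataH2 R U ρ w r ϖ G σ₂ σ₃ Rr L H₁ ψ₁ ψ₂ X₁ Bw E₀ κ μ D₁ Ψ₁ D₂ Ψ₂ δ η) :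
    ∃ x, ‖x‖ ≤ ρ ∧ ∀ y, ‖w 0 y‖ + (R.Y 1 - R.Y 0) + η < ‖w (Host.wfirstAt R) x‖ := by
  obtain ⟨x, hx, hsp⟩ := c.speed
  refine ⟨x, hx, fun y => ?_⟩
  have h0 := reference_initial_speed_lt c y
  linarith

end Generic

variable {U : EuclideanSpace ℝ (Fin 3) → EuclideanSpace ℝ (Fin 3)} {ρ : ℝ}
  {w r : ℝ → EuclideanSpace ℝ (Fin 3) → EuclideanSpace ℝ (Fin 3)} {ϖ : ℝ → EuclideanSpace ℝ (Fin 3) → ℝ}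
  {G σ₂ σ₃ Rr L H₁ ψ₁ ψ₂ X₁ : ℝ → ℝ} {Bw E₀ κ μ D₁ Ψ₁ D₂ Ψ₂ δ η : ℝ}

/-- **NO STEADY `H²` CERTIFICATE AT `tuned`** (`2Y₀ ≤ Y₁` there). [folklore] -/
theorem tuned_not_steady
    (c : CertificateDataH2 TowerRates.tuned U ρ w r ϖ G σ₂ σ₃ Rr L H₁ ψ₁ ψ₂ X₁ Bw E₀ κ μ D₁ Ψ₁ D₂ Ψ₂ δ η)
    (hsteady : w (Host.wfirstAt TowerRates.tuned) = w 0) : False := by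
  refine false_of_steady c hsteady ?_
  have hsep := TowerRates.tuned_sep 0
  have hY0 : 0 < TowerRates.tuned.Y 0 := Real.rpow_pos_of_pos (TowerRates.tuned.N_pos 0) _
  simp only [zero_add] at hsep
  linarith

/-- **SUP-SPEED GAIN OF MORE THAN ONE DATUM SCALE INSIDE 170 STRAIN TIMES at `tuned`**: the reference of any `H²` certificate at
the tuned rates has a point `‖x‖ ≤ ρ` with `‖w(w₀) x‖ > ‖w 0 y‖ + Y₀ + η` for EVERY `y`, where `w₀ = wfirstAt tuned`,
`w₀·A₀ ≤ 170` and `Y₀·w₀ ≤ 1/4`. [cite: Palasek2026ElementaryModel, §4] -/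
theorem tuned_speed_gain
    (c : CertificateDataH2 TowerRates.tuned U ρ w r ϖ G σ₂ σ₃ Rr L H₁ ψ₁ ψ₂ X₁ Bw E₀ κ μ D₁ Ψ₁ D₂ Ψ₂ δ η) :
    (∃ x, ‖x‖ ≤ ρ ∧ ∀ y, ‖w 0 y‖ + TowerRates.tuned.Y 0 + η < ‖w (Host.wfirstAt TowerRates.tuned) x‖) ∧
    Host.wfirstAt TowerRates.tuned * TowerRates.tuned.A 0 ≤ 170 ∧
    TowerRates.tuned.Y 0 * Host.wfirstAt TowerRates.tuned ≤ 1 / 4 := by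
  refine ⟨?_, EpisodeBaseTStrainDoorPrice.tuned_wfirst_mul_A_zero_le, TowerRates.tuned_Y_mul_window_le 0⟩
  obtain ⟨x, hx, hgain⟩ := speed_gain c
  refine ⟨x, hx, fun y => ?_⟩
  have h := hgain y
  have hsep := TowerRates.tuned_sep 0
  simp only [zero_add] at hsep
  linarith

end Summit.NavierStokesRegularity.EpisodeBaseTCertificateH2DatumSup

end
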